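import Summits.ResolutionOfSingularities.ResolutionOfSingularities.Theorems.PurelyInseparableDim4IsolationAutomorphism
import Summits.ResolutionOfSingularities.ResolutionOfSingularities.Theorems.PurelyInseparableDim4TschirnhausFrameStep
import Summits.ResolutionOfSingularities.ResolutionOfSingularities.Theorems.PurelyInseparableDim4TschirnhausJet
import Summits.ResolutionOfSingularities.ResolutionOfSingularities.Theorems.PurelyInseparableDim4ResCone
import Summits.ResolutionOfSingularities.ResolutionOfSingularities.Theorems.PurelyInseparableDim4RidgeBudget
import HarnessLib
import HarnessLib.Audit.Tags

/-!
# Purely inseparable four-folds — the Tschirnhaus / W-frame move PRESERVES the frame's letters: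
# isolation, the `q`-fold locus, `μ⁺`, the certificate level, the shade, the residual cone and `e_G`
# (cell `res-dim4-pi`, K2(p) lane, brick (ii) FILE C)

[OURS · counted 0 · cell `res-dim4-pi` · brick (ii) «Tschirnhaus / W-frame infrastructure», FILE C, desk
WORDS #81/#83, seat res-dim4-p-1 g3; over FILE A (`…IsolationAutomorphism`, res-dim4-p-11 g2), FILE B
(`…TschirnhausFrame` / `…TschirnhausFrameStep`, res-dim4-p-11 g2) and FILE D (`…TschirnhausJet`).]
Nothing here proves K2(p), `NoIsolatedTrap p p` or resolution of singularities in dimension ≥ 4 /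
characteristic `p`.  AI kernel work, weaker than expert review.

The re-coordinatised state of a presented state `s = (F, r, exc)` under the move `x_f ↦ x_f + φ(u)`
(`f` free, `φ(0) = 0`, `x_f ∉ vars φ`) is `⟨tsch f φ s.F, s.r, s.exc⟩`.  This file records that every
letter the K2(p) lane reads is the same before and after:

* §1 (origin-fixing automorphism, any `φ` with `φ(0) = 0`): `singLocusIdeal_tsch` (`J_q⁺` is transported),
  `map_originIdeal_tsch`, **`isIsolated_tsch_iff`**, **`jetColength_tsch`** (idea-3's `μ⁺` read at any
  level is frame-independent, by `Ideal.quotientEquivAlg`), **`isCert_tsch_iff`** (so are the certificate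
  levels), `shade_tschState` (from FILE B's `ordZero_tsch`).
* §2 (the Tschirnhaus part, `2 ≤ ord₀ φ`, is inert on initial forms — FILE B2's
  `initialForm_tsch_of_two_le`): `resForm_tschState`, `resVertex_tschState`, `finrank_resVertex_tschState`
  (`e_G`), `ebar_tsch` (`ē`).  The LINEAR part of a W-frame move changes `resForm` by the linear
  substitution and keeps `e_G` — that is FILE B3 (`…TschirnhausCone`, `finrank_resVertex_tschState_linear`).
* §3 FILE D in `tsch` clothing: **`exists_tsch_jet`** / `exists_tsch_jet_of_initialForm` (for every `N` an
  admissible `φ` with `ord₀ φ ≥ 2` killing the `x_f^{d-1}·u^m`-coefficients of `tsch f φ G`, `|m| ≤ N`) and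
  `tsch_jet_unique`; and the bundle **`exists_tsch_jet_state`**: the same `φ` re-coordinatises a state with
  `s.r f = 0` keeping `F = x^r·G` form, isolation, `ord₀`, shade, `resForm`, `resVertex`, `μ⁺`.

What is NOT here: the chain-level transport of the move along `Step0` segments (FILE E, res-dim4-p-11 g3),
the Hasse-contact dictionary (offered as D3), anything about termination.
bears_on: LADDER-RESOLUTION:D157-DOOR2 (res-dim4-pi · K2(p) · brick (ii) FILE C).  Supports
stmt-ResolutionOfSingularities-16155 (helper).
-/

set_option linter.dupNamespace false -- mandated namespace of this single-conjunct summit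

noncomputable section

namespace Summit.ResolutionOfSingularities.ResolutionOfSingularities.Theorems.PIDim4

namespace FrameChange

open MvPolynomial Finset
open Literature.AlgebraicGeometry.Resolution
open Literature.AlgebraicGeometry.Resolution.Hauser2010
open Literature.AlgebraicGeometry.Resolution.HauserPerlega2019

variable {K : Type} [Field K] {f : Fin 4} {φ : MvPolynomial (Fin 4) K}

/-! ## 1. The `q`-fold locus, isolation, `μ⁺`, certificates and the shade under the move -/

/-- The automorphism `tschEquiv f φ` fixes the origin when `φ(0) = 0`. [folklore] -/
theorem constantCoeff_tschEquiv_X (hφ : f ∉ φ.vars) (h0 : constantCoeff φ = 0) (i : Fin 4) :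
    constantCoeff (tschEquiv f φ hφ (X i)) = 0 :=
  constantCoeff_tsch_X h0 i

/-- **`J_q⁺(tsch F) = tsch (J_q⁺ F)`**: the `q`-fold-locus ideal is transported by the move.
[cite: EGAIV4, Prop. 16.8.8] [folklore] -/
theorem singLocusIdeal_tsch (q : ℕ) (hφ : f ∉ φ.vars) (F : MvPolynomial (Fin 4) K) :
    singLocusIdeal q (tsch f φ F) =
      (singLocusIdeal q F).map (tschEquiv f φ hφ : MvPolynomial (Fin 4) K →+* MvPolynomial (Fin 4) K) :=
  CoordChange.singLocusIdeal_algEquiv q (tschEquiv f φ hφ) F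

/-- The move maps `𝔪₀` onto `𝔪₀` (`φ(0) = 0`). [folklore] -/
theorem map_originIdeal_tsch (hφ : f ∉ φ.vars) (h0 : constantCoeff φ = 0) :
    (originIdeal K).map (tschEquiv f φ hφ : MvPolynomial (Fin 4) K →+* MvPolynomial (Fin 4) K) =
      originIdeal K :=
  CoordChange.map_originIdeal_algEquiv (tschEquiv f φ hφ) (constantCoeff_tschEquiv_X hφ h0)

/-- **Isolation is invariant under the move**: the origin is an isolated `q`-fold point of
`z^q + tsch f φ F` iff it is one of `z^q + F` (`φ(0) = 0`, `f ∉ vars φ`). [folklore] -/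
theorem isIsolated_tsch_iff (q : ℕ) (hφ : f ∉ φ.vars) (h0 : constantCoeff φ = 0)
    (F : MvPolynomial (Fin 4) K) : IsIsolated q (tsch f φ F) ↔ IsIsolated q F :=
  CoordChange.isIsolated_algEquiv_iff q (tschEquiv f φ hφ) (constantCoeff_tschEquiv_X hφ h0) F

/-- The ideal `J_q⁺ + 𝔪₀ᴺ` read by the jet colength is transported by the move. [folklore] -/
theorem singLocusIdeal_sup_pow_tsch (q N : ℕ) (hφ : f ∉ φ.vars) (h0 : constantCoeff φ = 0)
    (F : MvPolynomial (Fin 4) K) :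
    singLocusIdeal q (tsch f φ F) ⊔ originIdeal K ^ N =
      (singLocusIdeal q F ⊔ originIdeal K ^ N).map
        (tschEquiv f φ hφ : MvPolynomial (Fin 4) K →+* MvPolynomial (Fin 4) K) := by
  rw [Ideal.map_sup, Ideal.map_pow, map_originIdeal_tsch hφ h0, singLocusIdeal_tsch q hφ]

/-- **`μ⁺` is frame-independent**: the jet colength `dim_K K[x] ⧸ (J_q⁺(F) + 𝔪₀ᴺ)` of idea-3's ridge budget
is the same for `F` and `tsch f φ F`, at every level `N`. [folklore] -/
theorem jetColength_tsch (q N : ℕ) (hφ : f ∉ φ.vars) (h0 : constantCoeff φ = 0)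
    (F : MvPolynomial (Fin 4) K) :
    RidgeBudget.jetColength q N (tsch f φ F) = RidgeBudget.jetColength q N F := by
  unfold RidgeBudget.jetColength
  exact (Ideal.quotientEquivAlg (singLocusIdeal q F ⊔ originIdeal K ^ N)
    (singLocusIdeal q (tsch f φ F) ⊔ originIdeal K ^ N) (tschEquiv f φ hφ)
    (singLocusIdeal_sup_pow_tsch q N hφ h0 F)).toLinearEquiv.finrank_eq.symm

/-- **The certificate level is frame-independent**: `𝔪₀ᴺ ≤ J_q⁺ + 𝔪₀ᴺ⁺¹` holds for `tsch f φ F` iff it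
holds for `F`. [folklore] -/
theorem isCert_tsch_iff (q N : ℕ) (hφ : f ∉ φ.vars) (h0 : constantCoeff φ = 0)
    (F : MvPolynomial (Fin 4) K) :
    RidgeBudget.IsCert q N (tsch f φ F) ↔ RidgeBudget.IsCert q N F := by
  unfold RidgeBudget.IsCert
  have hbij : Function.Bijective
      (tschEquiv f φ hφ : MvPolynomial (Fin 4) K →+* MvPolynomial (Fin 4) K) :=
    (tschEquiv f φ hφ).bijective
  have key : ∀ I J : Ideal (MvPolynomial (Fin 4) K),
      I.map (tschEquiv f φ hφ : MvPolynomial (Fin 4) K →+* MvPolynomial (Fin 4) K) ≤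
          J.map (tschEquiv f φ hφ : MvPolynomial (Fin 4) K →+* MvPolynomial (Fin 4) K) ↔ I ≤ J :=
    fun I J => by
      rw [Ideal.map_le_iff_le_comap,
        Ideal.comap_map_of_bijective
          (tschEquiv f φ hφ : MvPolynomial (Fin 4) K →+* MvPolynomial (Fin 4) K) hbij]
  rw [singLocusIdeal_sup_pow_tsch q (N + 1) hφ h0 F,
    ← key (originIdeal K ^ N) (singLocusIdeal q F ⊔ originIdeal K ^ (N + 1)), Ideal.map_pow,
    map_originIdeal_tsch hφ h0]

/-- **The shade is frame-independent**: `shade ⟨tsch f φ s.F, s.r, s.exc⟩ = shade s` (`ord₀` is preserved,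
FILE B's `ordZero_tsch`, and `r` is untouched). [folklore] -/
theorem shade_tschState (hφ : f ∉ φ.vars) (h0 : constantCoeff φ = 0) (s : State K) :
    CentreBlowup.CState.shade (⟨tsch f φ s.F, s.r, s.exc⟩ : State K) = s.shade := by
  simp only [CentreBlowup.CState.shade, ordZero_tsch hφ h0]

/-! ## 2. The residual cone and `e_G` under the Tschirnhaus part (`2 ≤ ord₀ φ`) -/

/-- **The residual cone is unchanged** by the Tschirnhaus part of a W-frame move (`ord₀ φ ≥ 2` does not
touch initial forms, FILE B2). [folklore] -/
theorem resForm_tschState (hφ : f ∉ φ.vars) (h2 : (2 : ℕ∞) ≤ ordZero φ) (s : State K) :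
    ResCone.resForm (⟨tsch f φ s.F, s.r, s.exc⟩ : State K) = ResCone.resForm s := by
  simp only [ResCone.resForm, initialForm_tsch_of_two_le hφ h2]

/-- The vertex of the residual cone is unchanged by the Tschirnhaus part. [folklore] -/
theorem resVertex_tschState (hφ : f ∉ φ.vars) (h2 : (2 : ℕ∞) ≤ ordZero φ) (s : State K) :
    ResCone.resVertex (⟨tsch f φ s.F, s.r, s.exc⟩ : State K) = ResCone.resVertex s := by
  simp only [ResCone.resVertex, resForm_tschState hφ h2]

/-- `e_G = finrank (resVertex)` is unchanged by the Tschirnhaus part. [folklore] -/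
theorem finrank_resVertex_tschState (hφ : f ∉ φ.vars) (h2 : (2 : ℕ∞) ≤ ordZero φ) (s : State K) :
    Module.finrank K (ResCone.resVertex (⟨tsch f φ s.F, s.r, s.exc⟩ : State K)) =
      Module.finrank K (ResCone.resVertex s) := by
  rw [resVertex_tschState hφ h2]

/-- The directrix letter `ē = dim A(in F)` is unchanged by the Tschirnhaus part. [folklore] -/
theorem ebar_tsch (hφ : f ∉ φ.vars) (h2 : (2 : ℕ∞) ≤ ordZero φ) (F : MvPolynomial (Fin 4) K) :
    RidgeBudget.ebar (tsch f φ F) = RidgeBudget.ebar F := by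
  unfold RidgeBudget.ebar
  rw [initialForm_tsch_of_two_le hφ h2]

/-- `2 ≤ ord₀ φ` forces `φ(0) = 0`. [folklore] -/
theorem constantCoeff_eq_zero_of_two_le (h2 : (2 : ℕ∞) ≤ ordZero φ) : constantCoeff φ = 0 :=
  (one_le_ordZero_iff φ).mp (le_trans one_le_two h2)

/-! ## 3. FILE D in `tsch` clothing -/

/-- **Jet-level Tschirnhaus existence for `tsch`.**  `1 ≤ d` with `d ≠ 0` in `K`, `coeff_{x_f^d} G ≠ 0`,
no monomial `x_f^{d-1}` or `x_f^{d-1}·x_i`: for every `N` there is `φ` with `φ(0) = 0`, `f ∉ vars φ`,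
`ord₀ φ ≥ 2` such that every monomial `n` with `n_f = d − 1`, `|n| ≤ N + (d − 1)` has coefficient `0` in
`tsch f φ G`. [cite: Abhyankar1990, Lecture 22 p.174 and p.186] [cite: CossartPiltant2009, I.8.3.6]
[folklore] -/
theorem exists_tsch_jet (f : Fin 4) {d : ℕ} (hd : 1 ≤ d) (hdK : (d : K) ≠ 0)
    (G : MvPolynomial (Fin 4) K) (hc : coeff (Finsupp.single f d) G ≠ 0)
    (hG : ∀ m : Fin 4 →₀ ℕ, m f = 0 → m.degree ≤ 1 → coeff (m + Finsupp.single f (d - 1)) G = 0)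
    (N : ℕ) :
    ∃ φ : MvPolynomial (Fin 4) K, constantCoeff φ = 0 ∧ f ∉ φ.vars ∧ (2 : ℕ∞) ≤ ordZero φ ∧
      ∀ n : Fin 4 →₀ ℕ, n f = d - 1 → n.degree ≤ N + (d - 1) → coeff n (tsch f φ G) = 0 := by
  obtain ⟨φ, h0, hv, h2, hj⟩ := exists_tschirnhaus_jet f hd hdK G hc hG N
  exact ⟨φ, h0, hv, h2, hj (tsch f φ) (tsch_X_self f φ) fun _ hi => tsch_X_of_ne φ hi⟩

/-- The same from the frame's hypotheses `ord₀ G = d`, `in_d G = c·x_f^d` (`c ≠ 0`).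
[cite: CossartPiltant2009, I.8.3.6] [folklore] -/
theorem exists_tsch_jet_of_initialForm (f : Fin 4) {d : ℕ} (hd : 1 ≤ d) (hdK : (d : K) ≠ 0)
    (G : MvPolynomial (Fin 4) K) {c : K} (hc : c ≠ 0) (hord : ordZero G = d)
    (hin : initialForm G = C c * X f ^ d) (N : ℕ) :
    ∃ φ : MvPolynomial (Fin 4) K, constantCoeff φ = 0 ∧ f ∉ φ.vars ∧ (2 : ℕ∞) ≤ ordZero φ ∧
      ∀ n : Fin 4 →₀ ℕ, n f = d - 1 → n.degree ≤ N + (d - 1) → coeff n (tsch f φ G) = 0 := by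
  obtain ⟨φ, h0, hv, h2, hj⟩ := exists_tschirnhaus_jet_of_initialForm f hd hdK G hc hord hin N
  exact ⟨φ, h0, hv, h2, hj (tsch f φ) (tsch_X_self f φ) fun _ hi => tsch_X_of_ne φ hi⟩

/-- **Uniqueness of the Tschirnhaus jet for `tsch`**: two admissible `φ, ψ` killing the
`x_f^{d-1}·u^m`-coefficients (`|m| ≤ N`) of `tsch f · G` agree in all degrees `≤ N`.
[cite: Abhyankar1990, Lecture 22 p.174] [folklore] -/
theorem tsch_jet_unique (f : Fin 4) {d : ℕ} (hd : 1 ≤ d) (hdK : (d : K) ≠ 0)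
    (G : MvPolynomial (Fin 4) K) (hc : coeff (Finsupp.single f d) G ≠ 0) {N : ℕ}
    {φ ψ : MvPolynomial (Fin 4) K} (h0φ : constantCoeff φ = 0) (hφ : f ∉ φ.vars)
    (h0ψ : constantCoeff ψ = 0) (hψ : f ∉ ψ.vars)
    (hNφ : ∀ n : Fin 4 →₀ ℕ, n f = d - 1 → n.degree ≤ N + (d - 1) → coeff n (tsch f φ G) = 0)
    (hNψ : ∀ n : Fin 4 →₀ ℕ, n f = d - 1 → n.degree ≤ N + (d - 1) → coeff n (tsch f ψ G) = 0) :
    ∀ m : Fin 4 →₀ ℕ, m.degree ≤ N → coeff m φ = coeff m ψ :=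
  tschirnhaus_jet_unique f hd hdK G hc h0φ hφ h0ψ hψ (tsch f φ) (tsch f ψ) (tsch_X_self f φ)
    (fun _ hi => tsch_X_of_ne φ hi) (tsch_X_self f ψ) (fun _ hi => tsch_X_of_ne ψ hi) hNφ hNψ

/-- **The Tschirnhaus-normalised state.**  For a presented state `s` with `f` free (`s.r f = 0`) and
`s.F = x^{s.r} · G` with `coeff_{x_f^d} G ≠ 0`, no `x_f^{d-1}`/`x_f^{d-1}x_i` monomials, `d` a unit: for
every `N` there is an admissible `φ` (`φ(0) = 0`, `f ∉ vars φ`, `ord₀ φ ≥ 2`) such that the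
re-coordinatised state `s̃ = ⟨tsch f φ s.F, s.r, s.exc⟩` has `s̃.F = x^{s.r} · tsch f φ G` with the
`x_f^{d-1}·u^m`-coefficients of `tsch f φ G` zero for `|m| ≤ N`, and the same isolation predicate, `ord₀`,
shade, residual cone, vertex and jet colengths as `s`. [cite: Abhyankar1990, Lecture 22 p.174]
[folklore] -/
theorem exists_tsch_jet_state (q : ℕ) (s : State K) (f : Fin 4) (hrf : s.r f = 0)
    (G : MvPolynomial (Fin 4) K) (hFG : s.F = monomial s.r 1 * G) {d : ℕ} (hd : 1 ≤ d)
    (hdK : (d : K) ≠ 0) (hc : coeff (Finsupp.single f d) G ≠ 0)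
    (hG : ∀ m : Fin 4 →₀ ℕ, m f = 0 → m.degree ≤ 1 → coeff (m + Finsupp.single f (d - 1)) G = 0)
    (N : ℕ) :
    ∃ φ : MvPolynomial (Fin 4) K, constantCoeff φ = 0 ∧ f ∉ φ.vars ∧ (2 : ℕ∞) ≤ ordZero φ ∧
      tsch f φ s.F = monomial s.r 1 * tsch f φ G ∧
      (∀ n : Fin 4 →₀ ℕ, n f = d - 1 → n.degree ≤ N + (d - 1) → coeff n (tsch f φ G) = 0) ∧
      (IsIsolated q (tsch f φ s.F) ↔ IsIsolated q s.F) ∧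
      ordZero (tsch f φ s.F) = ordZero s.F ∧
      CentreBlowup.CState.shade (⟨tsch f φ s.F, s.r, s.exc⟩ : State K) = s.shade ∧
      ResCone.resForm (⟨tsch f φ s.F, s.r, s.exc⟩ : State K) = ResCone.resForm s ∧
      ResCone.resVertex (⟨tsch f φ s.F, s.r, s.exc⟩ : State K) = ResCone.resVertex s ∧
      ∀ M : ℕ, RidgeBudget.jetColength q M (tsch f φ s.F) = RidgeBudget.jetColength q M s.F := by
  obtain ⟨φ, h0, hv, h2, hj⟩ := exists_tsch_jet f hd hdK G hc hG N
  exact ⟨φ, h0, hv, h2, by rw [hFG, tsch_monomial_mul φ hrf], hj, isIsolated_tsch_iff q hv h0 s.F,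
    ordZero_tsch hv h0 s.F, shade_tschState hv h0 s, resForm_tschState hv h2 s,
    resVertex_tschState hv h2 s, fun M => jetColength_tsch q M hv h0 s.F⟩

end FrameChange

end Summit.ResolutionOfSingularities.ResolutionOfSingularities.Theorems.PIDim4

end
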